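import Summits.CriticalPhenomena.CardyFormulaZ2.Theses.CardyRotToConf
import Summits.CriticalPhenomena.CardyFormulaZ2.Theorems.CardyRotToConfR2SymmetryUpgrade.Negative.SurgCrosscutSplit
import Summits.CriticalPhenomena.CardyFormulaZ2.Theorems.CardyRotToConfR2SymmetryUpgrade.Negative.SurgJordanLocal
import Literature.Topology.PlaneTopology.CrosscutProofs
import Literature.Topology.PlaneTopology.JordanDomainLocalJoin
import Mathlib.Analysis.Convex.StrictConvexSpace
import HarnessLib

/-!
# Tip separation: both boundary branches of the remaining domain at the tip cannot be free
# (stub `stub_tipSeparation` of line `germ-label-transport`, crux `CardyRotToConfR2SymmetryUpgrade`,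
# stmt-CriticalPhenomena-0698)

Pure planar topology. `V ⊆ U` are Dobrushin domains with the same target `b = V.pt 1 = U.pt 1`,
`K ⊆ closure U` is connected, contains `a₀ = U.pt 0 ≠ z` and the tip `z = V.pt 0`, and misses
`V` (the past of a curve and the target-side remaining domain). If BOTH boundary branches of `∂V`
at `z` carry points of `∂U ∖ K` with parameters arbitrarily close to `V.mark 0`, we derive `False`
(`stub_tipSeparation`).

Proof.
* `z ∈ ∂U` (limit of such points), `z = U.boundary t` with `U.mark 0 < t < U.mark 0 + 1`,
  `t ≠ U.mark 1`. Fix a parameter window `(t - δ, t + δ)` avoiding the parameters of `a₀` and of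
  `b`; frontier points of `U` close to `z` have a parameter in the window
  (`JordanLocal.exists_radius_param_near`, compactness). By continuity of `V.boundary` at
  `V.mark 0` pick the two free points `p = V.boundary s`, `p' = V.boundary s'`,
  `s' < V.mark 0 < s < V.mark 1 < s' + 1`, that close to `z`.
* A cross-cut `L` of `V` from `p'` to `p` exists (`TipSeparation.exists_isCrosscut`: image of a
  chord of the closed unit disc under a Schoenflies homeomorphism `ℂ ≃ₜ ℂ` of `V`,
  `exists_schoenflies`). `K ∩ L = ∅` (interior points of `L` lie in `V`, `p, p' ∉ K`), so
  `z ∉ L`; also `b ∉ L`. Newman's theorem in `V` (`Newman1939_crosscut_holds`):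
  `V ∖ L = X₁ ⊔ X₂` with `z ∈ closure X₁`, `b ∈ closure X₂`.
* `L` is also a cross-cut of `U`, between `U.boundary u₁` and `U.boundary u₂`, `u₁ < u₂` both in
  the window. Newman in `U`: `U ∖ L = W₁ ⊔ W₂`, `∂W₁ = L ∪ U.boundary '' [u₁, u₂]` (the short
  arc). `W₁` meets `V` (an interior point of `L ⊆ ∂W₁` lies in the open set `V`), hence meets
  `X₁` or `X₂`, which then lies inside `W₁`. In the first case `z ∈ closure W₁ ∖ (W₁ ∪ L)` lies
  on the short arc strictly between the end-points, while `a₀ ∈ K` lies on the complementary open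
  arc: the connected set `K ⊆ closure U` meets `L` (`JordanDomain.inter_nonempty_of_crosscut`),
  contradiction. In the second case `b` lies on the short arc, i.e. `U.mark 1` is in the window,
  contradiction.

References: M. H. A. Newman, *Elements of the topology of plane sets of points* (1939), Ch. V §11,
Thms. 11·7–11·8; Ch. Pommerenke, *Boundary Behaviour of Conformal Maps* (1992), §2.3 Cor. 2.8
(Schoenflies).
-/

noncomputable section

open Set Metric Topology Filter

namespace Summit.CriticalPhenomena.CardyFormulaZ2.Theorems.CardyRotToConfR2SymmetryUpgrade

open Literature.Probability.RandomPlanarGeometry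
open Literature.Topology.PlaneTopology
open Summit.CriticalPhenomena.CardyFormulaZ2.Theorems.CardyRotToConfR2SymmetryUpgrade.Negative

namespace TipSeparation

/-- **A Jordan domain has a cross-cut between any two distinct boundary points**: the image of
the chord of the closed unit disc between the preimages of the two points under a Schoenflies
homeomorphism `ℂ ≃ₜ ℂ` carrying the open disc onto the domain and the circle onto its frontier
(`exists_schoenflies`); the open chord lies in the open disc by strict convexity.
[cite: PommerenkeBBCM1992, §2.3 Cor. 2.8] -/
theorem exists_isCrosscut (D : JordanDomain) {p q : ℂ} (hp : p ∈ frontier D.carrier)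
    (hq : q ∈ frontier D.carrier) (hpq : p ≠ q) : ∃ L : Set ℂ, D.IsCrosscut L p q := by
  obtain ⟨H, hball, hsphere, -⟩ := exists_schoenflies D
  rw [← hsphere] at hp hq
  obtain ⟨x, hx, rfl⟩ := hp
  obtain ⟨y, hy, rfl⟩ := hq
  have hxy : x ≠ y := fun h => hpq (h ▸ rfl)
  refine ⟨H '' segment ℝ x y, (IsSimpleArc.segment hxy).image H.continuous H.injective,
    by rw [← hsphere]; exact mem_image_of_mem H hx,
    by rw [← hsphere]; exact mem_image_of_mem H hy, hpq, ?_⟩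
  rintro _ ⟨⟨w, hw, rfl⟩, hne⟩
  rw [← hball]
  refine mem_image_of_mem H (openSegment_subset_ball_of_ne (sphere_subset_closedBall hx)
    (sphere_subset_closedBall hy) hxy ?_)
  rw [← insert_endpoints_openSegment] at hw
  rcases hw with rfl | rfl | hw
  · exact absurd (mem_insert _ _) hne
  · exact absurd (mem_insert_of_mem _ (mem_singleton _)) hne
  · exact hw

/-- **The nested cross-cut argument.** `L` is a cross-cut of the Dobrushin domain `U` between
`U.boundary u₁` and `U.boundary u₂`, `u₁ < u₂` both in a parameter window `(t - δ, t + δ)`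
(`δ ≤ 1/2`) that contains neither parameter of `a₀ = U.pt 0` (`U.mark 0 ≤ t - δ`,
`t + δ ≤ U.mark 0 + 1`) nor the parameter of `b = U.pt 1`; `L` meets an open set `O ⊆ U` with
`O ∖ L = X₁ ∪ X₂`, `X₁, X₂` preconnected, `z = U.boundary t ∈ closure X₁`, `b ∈ closure X₂`,
`z, b ∉ L`; and `K ⊆ closure U` is preconnected, misses `L` and contains `z` and `a₀`. Then
`False`: the component `W₁` of `U ∖ L` bounded by `L` and the short arc `U.boundary '' [u₁, u₂]`
(Newman 1939, Thm. 11·8) meets `O`, hence contains `X₁` or `X₂`; so `z` or `b` lies on the short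
arc; `b` cannot (window), and if `z` does, `K` joins the two open arcs of `∂U ∖ {end-points}`
inside `closure U ∖ L`, contradicting `JordanDomain.inter_nonempty_of_crosscut`.
[cite: Newman1939, Ch. V §11, Thms. 11·7 and 11·8] -/
theorem false_of_crosscut_near (U : DobrushinDomain) {O : Set ℂ} (hO : IsOpen O)
    (hOU : O ⊆ U.carrier) {L X₁ X₂ K : Set ℂ} {u₁ u₂ t δ : ℝ}
    (hδ1 : δ ≤ 1 / 2) (h0 : U.mark 0 ≤ t - δ) (h0' : t + δ ≤ U.mark 0 + 1)
    (h1 : U.mark 1 ≤ t - δ ∨ t + δ ≤ U.mark 1)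
    (hu₁ : u₁ ∈ Ioo (t - δ) (t + δ)) (hu₂ : u₂ ∈ Ioo (t - δ) (t + δ)) (hu : u₁ < u₂)
    (hcut : U.IsCrosscut L (U.boundary u₁) (U.boundary u₂)) (hLO : (L ∩ O).Nonempty)
    (hX : X₁ ∪ X₂ = O \ L) (hX₁ : IsPreconnected X₁) (hX₂ : IsPreconnected X₂)
    (hzX : U.boundary t ∈ closure X₁) (hbX : U.pt 1 ∈ closure X₂)
    (hzL : U.boundary t ∉ L) (hbL : U.pt 1 ∉ L)
    (hK : IsPreconnected K) (hKU : K ⊆ closure U.carrier) (hKL : Disjoint K L)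
    (hzK : U.boundary t ∈ K) (haK : U.pt 0 ∈ K) : False := by
  have hu' : u₂ < u₁ + 1 := by linarith [hu₁.1, hu₂.2]
  obtain ⟨W₁, W₂, hW₁o, hW₂o, -, -, hWdisj, hWunion, hfW₁, -⟩ :=
    Newman1939_crosscut_holds U.toJordanDomain L u₁ u₂ hu hu' hcut
  have hW₁U : W₁ ⊆ U.carrier := fun x hx => (hWunion.subset (Or.inl hx)).1
  -- `W₁` meets `O`: an interior point of `L ⊆ ∂W₁` lies in the open set `O`
  obtain ⟨w, hwL, hwO⟩ := hLO
  have hwW : w ∈ closure W₁ := by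
    rw [closure_eq_self_union_frontier, hfW₁]
    exact Or.inr (Or.inl hwL)
  obtain ⟨v, hvO, hvW⟩ := _root_.mem_closure_iff.1 hwW O hO hwO
  have hvL : v ∉ L := (hWunion.subset (Or.inl hvW)).2
  have hvX : v ∈ X₁ ∪ X₂ := by
    rw [hX]
    exact ⟨hvO, hvL⟩
  -- the pieces of `O ∖ L` lie in `W₁ ∪ W₂`
  have hXW : X₁ ∪ X₂ ⊆ W₁ ∪ W₂ := by
    rw [hX, hWunion]
    exact Set.sdiff_subset_sdiff_left hOU
  -- frontier points of `U` in `closure W₁` off `L` are on the short arc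
  have harc : ∀ x ∈ closure W₁, x ∉ U.carrier → x ∉ L →
      ∃ u ∈ Icc u₁ u₂, U.boundary u = x := by
    intro x hxW hxU hxL
    rw [closure_eq_self_union_frontier, hfW₁] at hxW
    rcases hxW with h | h | h
    · exact absurd (hW₁U h) hxU
    · exact absurd h hxL
    · exact h
  have hzU : U.boundary t ∉ U.carrier := fun h =>
    Set.disjoint_left.1 U.disjoint_carrier_frontier h (U.boundary_mem_frontier t)
  have hbU : U.pt 1 ∉ U.carrier := fun h =>
    Set.disjoint_left.1 U.disjoint_carrier_frontier h (U.pt_mem_frontier 1)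
  rcases hvX with hv | hv
  · -- `X₁ ⊆ W₁`: the tip is on the short arc, and `K` must cross `L`
    have hX₁W : X₁ ⊆ W₁ := by
      rcases hX₁.subset_or_subset hW₁o hW₂o hWdisj (subset_union_left.trans hXW) with h | h
      · exact h
      · exact absurd (h hv) (Set.disjoint_left.1 hWdisj hvW)
    obtain ⟨u, hu12, huz⟩ := harc _ (closure_mono hX₁W hzX) hzU hzL
    have hu₁' : u₁ < u := by
      refine lt_of_le_of_ne hu12.1 ?_
      rintro rfl
      exact hzL (by rw [← huz]; exact hcut.1.left_mem)
    have hu₂' : u < u₂ := by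
      refine lt_of_le_of_ne hu12.2 ?_
      rintro rfl
      exact hzL (by rw [← huz]; exact hcut.1.right_mem)
    obtain ⟨x, hxK, hxL⟩ := U.toJordanDomain.inter_nonempty_of_crosscut
      Newman1939_crosscut_holds hu hu' hcut hK hKU ⟨hu₁', hu₂'⟩ (by rw [huz]; exact hzK)
      (u' := U.mark 0 + 1) ⟨by linarith [hu₂.2], by linarith [hu₁.1]⟩
      (by rw [U.periodic_boundary]; exact haK)
    exact Set.disjoint_left.1 hKL hxK hxL
  · -- `X₂ ⊆ W₁`: the target would be on the short arc
    have hX₂W : X₂ ⊆ W₁ := by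
      rcases hX₂.subset_or_subset hW₁o hW₂o hWdisj (subset_union_right.trans hXW) with h | h
      · exact h
      · exact absurd (h hv) (Set.disjoint_left.1 hWdisj hvW)
    obtain ⟨u, hu12, hub⟩ := harc _ (closure_mono hX₂W hbX) hbU hbL
    have hum : u = U.mark 1 :=
      U.injOn_boundary_Ico (U.mark 0) ⟨by linarith [hu12.1, hu₁.1], by linarith [hu12.2, hu₂.2]⟩
        ⟨(mark_zero_lt_mark_one U).le, mark_one_lt_mark_zero_add_one U⟩ hub
    rcases h1 with h1 | h1
    · linarith [hu12.1, hu₁.1]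
    · linarith [hu12.2, hu₂.2]

end TipSeparation

open TipSeparation in
/-- **S7d. Tip separation** (pure planar topology). `V ⊆ U` Dobrushin domains with the same
target, `K` a connected subset of `closure U` containing `U.pt 0 ≠ V.pt 0` and `V.pt 0`,
disjoint from `V` (the past of a curve and the target-side remaining domain). If BOTH boundary
branches of `V` at `V.pt 0` contain points of `∂U ∖ K` arbitrarily close to the mark (in
parameter), contradiction: a cross-cut of `U` through `V` between two such points close to the
tip separates `V.pt 0` from `U.pt 0` in `closure U` (Newman's cross-cut theorem
`Newman1939_crosscut_holds` in `V` and in `U`, Schoenflies homeomorphism of `closure V` for the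
existence of the cross-cut), while `K` is connected and misses the cross-cut.
[cite: Newman1939, Ch. V §11, Thms. 11·7 and 11·8] -/
theorem stub_tipSeparation :
    ∀ (U V : DobrushinDomain) (K : Set ℂ), V.carrier ⊆ U.carrier → V.pt 1 = U.pt 1 →
      U.pt 0 ≠ V.pt 0 → IsConnected K → K ⊆ closure U.carrier → U.pt 0 ∈ K → V.pt 0 ∈ K →
      Disjoint K V.carrier →
      (∀ ε : ℝ, 0 < ε →
        (∃ s ∈ Set.Ioo (V.mark 0) (V.mark 0 + ε),
          V.boundary s ∈ frontier U.carrier ∧ V.boundary s ∉ K) ∧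
        (∃ s ∈ Set.Ioo (V.mark 0 - ε) (V.mark 0),
          V.boundary s ∈ frontier U.carrier ∧ V.boundary s ∉ K)) →
      False := by
  intro U V K hVU hb ha hK hKU haK hzK hKV hε
  have hzdef : V.pt 0 = V.boundary (V.mark 0) := rfl
  have hbdef : V.pt 1 = V.boundary (V.mark 1) := rfl
  have hm01 : V.mark 0 < V.mark 1 := mark_zero_lt_mark_one V
  have hm10 : V.mark 1 < V.mark 0 + 1 := mark_one_lt_mark_zero_add_one V
  have hcont : ContinuousAt V.boundary (V.mark 0) := V.continuous_boundary.continuousAt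
  -- the tip is on `∂U`
  have hzF : V.pt 0 ∈ frontier U.carrier := by
    have h : V.pt 0 ∈ closure (frontier U.carrier) := by
      rw [Metric.mem_closure_iff]
      intro r hr
      obtain ⟨η, hη, hηr⟩ := Metric.continuousAt_iff.1 hcont r hr
      obtain ⟨⟨s, hs, hsF, -⟩, -⟩ := hε η hη
      refine ⟨V.boundary s, hsF, ?_⟩
      rw [hzdef, dist_comm]
      exact hηr (by rw [Real.dist_eq, abs_lt]; constructor <;> linarith [hs.1, hs.2])
    rwa [isClosed_frontier.closure_eq] at h
  -- parameter of the tip on `∂U` and the window `δ`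
  obtain ⟨t, ht0, ht1, htz⟩ := exists_param_of_mem_frontier U hzF ha.symm
  have htm : t ≠ U.mark 1 := by
    intro h
    refine V.pt_injective.ne (show (0 : Fin 2) ≠ 1 by decide) ?_
    rw [← htz, h, hb]
    rfl
  obtain ⟨δ, hδ, hδ1, hδ0, hδ0', hδm⟩ : ∃ δ : ℝ, 0 < δ ∧ δ ≤ 1 / 2 ∧ U.mark 0 ≤ t - δ ∧
      t + δ ≤ U.mark 0 + 1 ∧ (U.mark 1 ≤ t - δ ∨ t + δ ≤ U.mark 1) := by
    have hm := mark_zero_lt_mark_one U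
    have hm' := mark_one_lt_mark_zero_add_one U
    rcases lt_or_gt_of_ne htm with h | h
    · have h₁ := min_le_right (1 / 2 : ℝ) (min (t - U.mark 0) (U.mark 1 - t))
      have h₂ := min_le_left (t - U.mark 0) (U.mark 1 - t)
      have h₃ := min_le_right (t - U.mark 0) (U.mark 1 - t)
      exact ⟨min (1 / 2) (min (t - U.mark 0) (U.mark 1 - t)),
        lt_min (by norm_num) (lt_min (by linarith) (by linarith)), min_le_left _ _,
        by linarith, by linarith, Or.inr (by linarith)⟩
    · have h₁ := min_le_right (1 / 2 : ℝ) (min (t - U.mark 1) (U.mark 0 + 1 - t))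
      have h₂ := min_le_left (t - U.mark 1) (U.mark 0 + 1 - t)
      have h₃ := min_le_right (t - U.mark 1) (U.mark 0 + 1 - t)
      exact ⟨min (1 / 2) (min (t - U.mark 1) (U.mark 0 + 1 - t)),
        lt_min (by norm_num) (lt_min (by linarith) (by linarith)), min_le_left _ _,
        by linarith, by linarith, Or.inl (by linarith)⟩
  -- frontier points of `U` near the tip have a parameter in the window
  obtain ⟨r, hr, hnear⟩ := JordanLocal.exists_radius_param_near U.toJordanDomain t hδ hδ1
  -- the two free points, close to the tip
  obtain ⟨η, hη, hηr⟩ := Metric.continuousAt_iff.1 hcont r hr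
  have hε₁ := min_le_left η (min (V.mark 1 - V.mark 0) (V.mark 0 + 1 - V.mark 1))
  have hε₂ := min_le_right η (min (V.mark 1 - V.mark 0) (V.mark 0 + 1 - V.mark 1))
  have hε₃ := min_le_left (V.mark 1 - V.mark 0) (V.mark 0 + 1 - V.mark 1)
  have hε₄ := min_le_right (V.mark 1 - V.mark 0) (V.mark 0 + 1 - V.mark 1)
  obtain ⟨⟨s, hs, hsF, hsK⟩, ⟨s', hs', hs'F, hs'K⟩⟩ :=
    hε (min η (min (V.mark 1 - V.mark 0) (V.mark 0 + 1 - V.mark 1)))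
      (lt_min hη (lt_min (by linarith) (by linarith)))
  have h₁ : s' < V.mark 0 := hs'.2
  have h₂ : V.mark 0 < s := hs.1
  have h₃ : s < V.mark 1 := by linarith [hs.2]
  have h₄ : V.mark 1 < s' + 1 := by linarith [hs'.1]
  have hs's : s' < s := h₁.trans h₂
  have hss' : s < s' + 1 := by linarith
  have hds : dist (V.boundary s) (U.boundary t) < r := by
    rw [htz, hzdef]
    exact hηr (by rw [Real.dist_eq, abs_lt]; constructor <;> linarith [hs.1, hs.2])
  have hds' : dist (V.boundary s') (U.boundary t) < r := by
    rw [htz, hzdef]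
    exact hηr (by rw [Real.dist_eq, abs_lt]; constructor <;> linarith [hs'.1, hs'.2])
  -- injectivity of `V.boundary` on the period `[s', s' + 1)`
  have hinj := V.injOn_boundary_Ico s'
  have hmem_s : s ∈ Ico s' (s' + 1) := ⟨hs's.le, hss'⟩
  have hmem_s' : s' ∈ Ico s' (s' + 1) := ⟨le_rfl, by linarith⟩
  have hmem_m₁ : V.mark 1 ∈ Ico s' (s' + 1) := ⟨by linarith, h₄⟩
  have hpp' : V.boundary s' ≠ V.boundary s := fun h => hs's.ne (hinj hmem_s' hmem_s h)
  -- a cross-cut of `V` between the two free points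
  obtain ⟨L, hLV⟩ := exists_isCrosscut V.toJordanDomain (V.boundary_mem_frontier s')
    (V.boundary_mem_frontier s) hpp'
  have hLsub : L \ {V.boundary s', V.boundary s} ⊆ V.carrier := hLV.2.2.2.2
  have hoffL : ∀ x ∈ L, x ≠ V.boundary s' → x ≠ V.boundary s → x ∈ V.carrier :=
    fun x hxL hx₁ hx₂ => hLsub ⟨hxL, by
      simp only [mem_insert_iff, mem_singleton_iff, not_or]; exact ⟨hx₁, hx₂⟩⟩
  have hKL : Disjoint K L := by
    rw [Set.disjoint_left]
    intro x hxK hxL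
    exact Set.disjoint_left.1 hKV hxK
      (hoffL x hxL (fun h => hs'K (h ▸ hxK)) (fun h => hsK (h ▸ hxK)))
  have hzL : V.pt 0 ∉ L := fun h => Set.disjoint_left.1 hKL hzK h
  have hbV : V.pt 1 ∉ V.carrier := fun h =>
    Set.disjoint_left.1 V.disjoint_carrier_frontier h (V.pt_mem_frontier 1)
  have hbL : V.pt 1 ∉ L := by
    intro h
    refine hbV (hoffL _ h (fun h' => ?_) (fun h' => ?_))
    · have := hinj hmem_m₁ hmem_s' h'
      linarith
    · have := hinj hmem_m₁ hmem_s h'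
      linarith
  have hLO : (L ∩ V.carrier).Nonempty := by
    -- an interior point of the arc, e.g. the image of the parameter `1/2`
    obtain ⟨γ, -, hγinj, hγL, hγ0, hγ1⟩ := hLV.1
    have hm : (1 / 2 : ℝ) ∈ Icc (0 : ℝ) 1 := ⟨by norm_num, by norm_num⟩
    have hxL : γ (1 / 2) ∈ L := hγL ▸ mem_image_of_mem γ hm
    refine ⟨γ (1 / 2), hxL, hoffL _ hxL (fun h => ?_) (fun h => ?_)⟩
    · have := hγinj hm (left_mem_Icc.2 zero_le_one) (h.trans hγ0.symm)
      norm_num at this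
    · have := hγinj hm (right_mem_Icc.2 zero_le_one) (h.trans hγ1.symm)
      norm_num at this
  -- Newman in `V`: the tip and the target are on the two sides
  obtain ⟨X₁, X₂, -, -, hX₁c, hX₂c, -, hXunion, hfX₁, hfX₂⟩ :=
    Newman1939_crosscut_holds V.toJordanDomain L s' s hs's hss' hLV
  have hzX : V.pt 0 ∈ closure X₁ := by
    refine frontier_subset_closure ?_
    rw [hfX₁, hzdef]
    exact Or.inr ⟨V.mark 0, ⟨h₁.le, h₂.le⟩, rfl⟩
  have hbX : V.pt 1 ∈ closure X₂ := by
    refine frontier_subset_closure ?_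
    rw [hfX₂, hbdef]
    exact Or.inr ⟨V.mark 1, ⟨h₃.le, h₄.le⟩, rfl⟩
  -- parameters of the two free points on `∂U`, and the nested cross-cut argument
  obtain ⟨u, hu, hup⟩ := hnear _ hsF hds
  obtain ⟨u', hu', hup'⟩ := hnear _ hs'F hds'
  have huu' : u ≠ u' := fun h => hpp' (by rw [← hup, ← hup', h])
  rw [hb] at hbX hbL
  rw [← htz] at hzX hzL hzK
  rcases lt_or_gt_of_ne huu' with hlt | hlt
  · have hcut : U.IsCrosscut L (U.boundary u) (U.boundary u') := by
      rw [hup, hup']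
      refine ⟨hLV.1.symm, hsF, hs'F, hpp'.symm, ?_⟩
      rw [Set.pair_comm]
      exact hLsub.trans hVU
    exact false_of_crosscut_near U V.isOpen hVU hδ1 hδ0 hδ0' hδm hu hu' hlt hcut hLO hXunion
      hX₁c.isPreconnected hX₂c.isPreconnected hzX hbX hzL hbL hK.isPreconnected hKU hKL hzK haK
  · have hcut : U.IsCrosscut L (U.boundary u') (U.boundary u) := by
      rw [hup, hup']
      exact ⟨hLV.1, hs'F, hsF, hpp', hLsub.trans hVU⟩
    exact false_of_crosscut_near U V.isOpen hVU hδ1 hδ0 hδ0' hδm hu' hu hlt hcut hLO hXunion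
      hX₁c.isPreconnected hX₂c.isPreconnected hzX hbX hzL hbL hK.isPreconnected hKU hKL hzK haK

end Summit.CriticalPhenomena.CardyFormulaZ2.Theorems.CardyRotToConfR2SymmetryUpgrade
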